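import Summits.NavierStokesRegularity.NavierStokesRegularity.Theorems.UnthreadedDoorIndicatrixAnalyticCellFiniteness
import HarnessLib

/-!
# Route `UnthreadedDoor`, crux `PoloidalLiouville` (stmt-NavierStokesRegularity-1222), WALL W1 — crux idea «indicatrix-bound» (ns-idea-14):
# Λ-geo′(a) `AnalyticCellFinitenessUniformSlice` and Λ-geo′(b) `AnalyticCellFinitenessUniformBox` — UNIFORM cell counts
# (M-Lean bridges from F2, Bierstone–Milman Thm. 3.14: boundedly many components in the fibres of an analytic sign-set family)

Support file (theorems only; `--supports stmt-NavierStokesRegularity-1222 --as helper`).  The registered stubs Λ-geo′(a)/(b) of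
`Cruxes/PoloidalLiouville/IndicatrixSketch.lean` (v1.7.3, l.779 / l.789) are the implications
`F1 → F2 → AnalyticCellFinitenessUniformSlice` and `F2 → AnalyticCellFinitenessUniformBox`.  Proof = the custodian's recipes (v1.5):
* (a) F2 with one real parameter `p 0 = r`: `U = {x₀}ᶜ`, `H (p, x) = ‖x − x₀‖² − (p 0)²`, `G (p, x) = ‖∇f x × (x − x₀)‖²`, box
  `Icc (fun _ ↦ a) (fun _ ↦ b)`; the compact set `{p ∈ box, x ∈ U, H = 0}` is closed and bounded (`‖x − x₀‖ = p 0 ∈ [a, b]`, `a > 0`);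
* (b) F2 with two parameters `p 0 = t`, `p 1 = r`: `P = {t₀ < p 0 < 0}`, box `Icc ![t₁, a] ![t₂, b]`, `G (p, x) = ‖∇ₓT (p 0) x × (x − x₀)‖²`, jointly
  analytic on `P ×ˢ U` because `fderiv ℝ (T t) x = fderiv ℝ (uncurry T) (t, x) ∘L inr` on the open slab (`AnalyticOnNhd.fderiv` + `AnalyticOnNhd.congr`);
* the fibres are `sphCrit` and `S_r ∖ sphCrit` (`sphCrit_eq_signSet'`, `sphere_diff_sphCrit_eq_signSet`), and the countings (i)/(ii) of
  `UnthreadedDoorIndicatrixAnalyticCellFiniteness` (p727975) turn F2's bound `N` into `ncard isoCrit ≤ N`, `ncard cellSet ≤ 2N`.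
F1 is not needed for (a) (F2 already hands finiteness); it stays in the signature because the stub is typed that way.  Nothing here is about
Navier–Stokes; ⟨1222⟩, W1 and NS regularity stay OPEN.  ARM A `pub/ns-exp-scalarLiouville` g8.
-/

noncomputable section

-- the summit and its single sub-problem share the name (CONVENTIONS §1)
set_option linter.dupNamespace false

open Set Function Filter Topology
open scoped RealInnerProductSpace

namespace Summit.NavierStokesRegularity.NavierStokesRegularity.Theorems.PoloidalLiouville.Indicatrix

open Summit.NavierStokesRegularity.NavierStokesRegularity.Theorems.PoloidalLiouville.NetFlux (E3)
open Summit.NavierStokesRegularity.NavierStokesRegularity.Theorems.PoloidalLiouville.CellFlux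
  (sphCrit sheetTrace isoCrit cellOf cellSet)
open Literature.Analysis Literature.Analysis.FluidPDE

/-! ### The family of spheres `{(p, x) : ‖x − x₀‖ = p i}` over a box is compact; the defining function is analytic -/

/-- For a box of parameters with `a i > 0`, the set `{(p, x) : p ∈ Icc a b, x ≠ x₀, ‖x − x₀‖² = (p i)²}` is compact. [folklore] -/
theorem isCompact_sphereFamily {m : ℕ} (x₀ : E3) (a b : Fin m → ℝ) (i : Fin m) (ha : 0 < a i) :
    IsCompact {q : (Fin m → ℝ) × E3 | q.1 ∈ Icc a b ∧ q.2 ∈ ({x₀}ᶜ : Set E3) ∧ ‖q.2 - x₀‖ ^ 2 - (q.1 i) ^ 2 = 0} := by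
  have hnorm : ∀ q : (Fin m → ℝ) × E3, q.1 ∈ Icc a b → ‖q.2 - x₀‖ ^ 2 - (q.1 i) ^ 2 = 0 → ‖q.2 - x₀‖ = q.1 i := by
    intro q hq hH
    have hp : 0 ≤ q.1 i := ha.le.trans (hq.1 i)
    have h1 : (‖q.2 - x₀‖ - q.1 i) * (‖q.2 - x₀‖ + q.1 i) = 0 := by
      have : (‖q.2 - x₀‖ - q.1 i) * (‖q.2 - x₀‖ + q.1 i) = ‖q.2 - x₀‖ ^ 2 - (q.1 i) ^ 2 := by ring
      rw [this, hH]
    rcases mul_eq_zero.mp h1 with h | h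
    · linarith
    · have := norm_nonneg (q.2 - x₀)
      have h2 : ‖q.2 - x₀‖ = 0 := by linarith
      have h3 : q.1 i = 0 := by linarith
      linarith [hq.1 i]
  have heq : {q : (Fin m → ℝ) × E3 | q.1 ∈ Icc a b ∧ q.2 ∈ ({x₀}ᶜ : Set E3) ∧ ‖q.2 - x₀‖ ^ 2 - (q.1 i) ^ 2 = 0} =
      {q : (Fin m → ℝ) × E3 | q.1 ∈ Icc a b ∧ ‖q.2 - x₀‖ ^ 2 - (q.1 i) ^ 2 = 0} := by
    ext q
    simp only [mem_setOf_eq, mem_compl_iff, mem_singleton_iff]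
    constructor
    · rintro ⟨h1, -, h3⟩; exact ⟨h1, h3⟩
    · rintro ⟨h1, h3⟩
      refine ⟨h1, fun hx => ?_, h3⟩
      have h4 := hnorm q h1 h3
      rw [hx, sub_self, norm_zero] at h4
      linarith [h1.1 i]
  rw [heq]
  have hclosed : IsClosed {q : (Fin m → ℝ) × E3 | q.1 ∈ Icc a b ∧ ‖q.2 - x₀‖ ^ 2 - (q.1 i) ^ 2 = 0} := by
    refine (isClosed_Icc.preimage continuous_fst).inter (isClosed_eq ?_ continuous_const)
    fun_prop
  have hsub : {q : (Fin m → ℝ) × E3 | q.1 ∈ Icc a b ∧ ‖q.2 - x₀‖ ^ 2 - (q.1 i) ^ 2 = 0} ⊆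
      Icc a b ×ˢ Metric.closedBall x₀ (b i) := by
    rintro q ⟨h1, h3⟩
    refine ⟨h1, ?_⟩
    rw [Metric.mem_closedBall, dist_eq_norm, hnorm q h1 h3]
    exact h1.2 i
  exact (isCompact_Icc.prod (isCompact_closedBall x₀ (b i))).of_isClosed_subset hclosed hsub

/-- `(p, x) ↦ ‖x − x₀‖² − (p i)²` is analytic. [folklore] -/
theorem analyticOnNhd_H {m : ℕ} (x₀ : E3) (i : Fin m) (S : Set ((Fin m → ℝ) × E3)) :
    AnalyticOnNhd ℝ (fun q : (Fin m → ℝ) × E3 => ‖q.2 - x₀‖ ^ 2 - (q.1 i) ^ 2) S := by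
  have h1 : AnalyticOnNhd ℝ (fun q : (Fin m → ℝ) × E3 => q.2 - x₀) S := analyticOnNhd_snd.sub analyticOnNhd_const
  have h2 : AnalyticOnNhd ℝ (fun q : (Fin m → ℝ) × E3 => ⟪q.2 - x₀, q.2 - x₀⟫) S :=
    ((innerSL ℝ (E := E3)).analyticOnNhd_bilinear univ).comp₂ h1 h1 (fun _ _ => mem_univ _)
  have h3 : AnalyticOnNhd ℝ (fun q : (Fin m → ℝ) × E3 => q.1 i) S :=
    ((ContinuousLinearMap.proj i).comp (ContinuousLinearMap.fst ℝ (Fin m → ℝ) E3)).analyticOnNhd S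
  have h4 : (fun q : (Fin m → ℝ) × E3 => ‖q.2 - x₀‖ ^ 2 - (q.1 i) ^ 2) =
      fun q => ⟪q.2 - x₀, q.2 - x₀⟫ - (q.1 i) ^ 2 := by
    funext q; rw [real_inner_self_eq_norm_sq]
  rw [h4]
  exact h2.sub (h3.pow 2)

/-- Membership in a `Fin 2` box. [folklore] -/
theorem vec2_mem_Icc {t₁ t₂ a b t r : ℝ} (ht : t ∈ Icc t₁ t₂) (hr : r ∈ Icc a b) :
    (![t, r] : Fin 2 → ℝ) ∈ Icc (![t₁, a] : Fin 2 → ℝ) ![t₂, b] := by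
  refine ⟨fun j => ?_, fun j => ?_⟩ <;> fin_cases j <;> simp [ht.1, ht.2, hr.1, hr.2]

/-! ### Λ-geo′(a): radius-uniform counts for one analytic slice -/

/-- ★ **Λ-geo′(a) from F1 + F2**: `BierstoneMilman1988_signSet_components_finite → BierstoneMilman1988_fibre_components_bounded →
AnalyticCellFinitenessUniformSlice`, all three bodies VERBATIM from `Cruxes/PoloidalLiouville/IndicatrixSketch.lean` v1.7.3 (§F l.615,
l.625; §1 l.320).  (F1 is not used.) [folklore] -/
theorem analyticCellFinitenessUniformSlice_of
    (_hF1 : ∀ (E : Type) [NormedAddCommGroup E] [NormedSpace ℝ E] [FiniteDimensional ℝ E] (U : Set E) (h g : E → ℝ),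
      IsOpen U → AnalyticOnNhd ℝ h U → AnalyticOnNhd ℝ g U → IsCompact {x | x ∈ U ∧ h x = 0} →
        (connectedComponentIn {x | x ∈ U ∧ h x = 0 ∧ g x = 0} '' {x | x ∈ U ∧ h x = 0 ∧ g x = 0}).Finite ∧
        (connectedComponentIn {x | x ∈ U ∧ h x = 0 ∧ g x ≠ 0} '' {x | x ∈ U ∧ h x = 0 ∧ g x ≠ 0}).Finite)
    (hF2 : ∀ (m : ℕ) (E : Type) [NormedAddCommGroup E] [NormedSpace ℝ E] [FiniteDimensional ℝ E]
      (P : Set (Fin m → ℝ)) (U : Set E) (a b : Fin m → ℝ) (H G : (Fin m → ℝ) × E → ℝ),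
      IsOpen P → IsOpen U → Set.Icc a b ⊆ P → AnalyticOnNhd ℝ H (P ×ˢ U) → AnalyticOnNhd ℝ G (P ×ˢ U) →
      IsCompact {q : (Fin m → ℝ) × E | q.1 ∈ Set.Icc a b ∧ q.2 ∈ U ∧ H q = 0} →
        ∃ N : ℕ, ∀ p ∈ Set.Icc a b,
          (connectedComponentIn {x | x ∈ U ∧ H (p, x) = 0 ∧ G (p, x) = 0} '' {x | x ∈ U ∧ H (p, x) = 0 ∧ G (p, x) = 0}).Finite ∧
          (connectedComponentIn {x | x ∈ U ∧ H (p, x) = 0 ∧ G (p, x) = 0} '' {x | x ∈ U ∧ H (p, x) = 0 ∧ G (p, x) = 0}).ncard ≤ N ∧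
          (connectedComponentIn {x | x ∈ U ∧ H (p, x) = 0 ∧ G (p, x) ≠ 0} '' {x | x ∈ U ∧ H (p, x) = 0 ∧ G (p, x) ≠ 0}).Finite ∧
          (connectedComponentIn {x | x ∈ U ∧ H (p, x) = 0 ∧ G (p, x) ≠ 0} '' {x | x ∈ U ∧ H (p, x) = 0 ∧ G (p, x) ≠ 0}).ncard ≤ N) :
    ∀ (x₀ : E3) (f : E3 → ℝ) (a b : ℝ), 0 < a → a ≤ b → AnalyticOnNhd ℝ f ({x₀}ᶜ : Set E3) →
      ∃ N : ℕ, ∀ r ∈ Icc a b,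
        (cellSet f x₀ r).Finite ∧ (cellSet f x₀ r).ncard ≤ N ∧ (isoCrit f x₀ r).Finite ∧ (isoCrit f x₀ r).ncard ≤ N := by
  intro x₀ f a b ha hab hf
  -- F2 with one parameter `p 0 = r`
  obtain ⟨N, hN⟩ := hF2 1 E3 univ ({x₀}ᶜ : Set E3) (fun _ => a) (fun _ => b)
    (fun q => ‖q.2 - x₀‖ ^ 2 - (q.1 0) ^ 2) (fun q => ‖cross (gradient f q.2) (q.2 - x₀)‖ ^ 2)
    isOpen_univ isOpen_compl_singleton (subset_univ _) (analyticOnNhd_H x₀ 0 _)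
    ((analyticOnNhd_g hf x₀).comp analyticOnNhd_snd (fun q hq => hq.2))
    (isCompact_sphereFamily x₀ (fun _ => a) (fun _ => b) 0 ha)
  refine ⟨N + N, fun r hr => ?_⟩
  have hr0 : 0 < r := ha.trans_le hr.1
  have hp : (fun _ : Fin 1 => r) ∈ Icc (fun _ : Fin 1 => a) (fun _ => b) := ⟨fun _ => hr.1, fun _ => hr.2⟩
  obtain ⟨h0f, h0N, h1f, h1N⟩ := hN _ hp
  simp only at h0f h0N h1f h1N
  rw [← sphCrit_eq_signSet' f x₀ hr0] at h0f h0N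
  rw [← sphere_diff_sphCrit_eq_signSet f x₀ hr0] at h1f h1N
  obtain ⟨hcf, hcN⟩ := cellSet_finite_of_components_finite f x₀ r h0f h1f
  obtain ⟨hif, hiN⟩ := isoCrit_finite_of_components_finite f x₀ r h0f
  exact ⟨hcf, hcN.trans (add_le_add h1N h0N), hif, hiN.trans (h0N.trans (Nat.le_add_right N N))⟩

/-! ### Λ-geo′(b): box-uniform counts for a jointly analytic `T` -/

/-- Joint analyticity of `(p, x) ↦ ‖∇ₓT (p 0) x × (x − x₀)‖²` on `{t₀ < p 0 < 0} × {x₀}ᶜ` from joint analyticity of `T` on the slab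
(`fderiv ℝ (T t) x = fderiv ℝ (uncurry T) (t, x) ∘L inr` there). [folklore] -/
theorem analyticOnNhd_G_box {T : ℝ → E3 → ℝ} {x₀ : E3} {t₀ : ℝ}
    (hT : AnalyticOnNhd ℝ (uncurry T) (Ioo t₀ 0 ×ˢ ({x₀}ᶜ : Set E3))) :
    AnalyticOnNhd ℝ (fun q : (Fin 2 → ℝ) × E3 => ‖cross (gradient (T (q.1 0)) q.2) (q.2 - x₀)‖ ^ 2)
      ({p : Fin 2 → ℝ | t₀ < p 0 ∧ p 0 < 0} ×ˢ ({x₀}ᶜ : Set E3)) := by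
  -- the Riesz map as a real continuous linear map
  obtain ⟨Φ, hΦ⟩ : ∃ Φ : (E3 →L[ℝ] ℝ) →L[ℝ] E3, ∀ L, Φ L = (InnerProductSpace.toDual ℝ E3).symm L :=
    ⟨{ toFun := fun L => (InnerProductSpace.toDual ℝ E3).symm L
       map_add' := fun L L' => by simp
       map_smul' := fun c L => by simp
       cont := (InnerProductSpace.toDual ℝ E3).symm.continuous }, fun _ => rfl⟩
  set P : Set (Fin 2 → ℝ) := {p : Fin 2 → ℝ | t₀ < p 0 ∧ p 0 < 0} with hP
  have hPo : IsOpen P := by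
    have h1 : Continuous fun p : Fin 2 → ℝ => p 0 := continuous_apply 0
    exact (isOpen_lt continuous_const h1).inter (isOpen_lt h1 continuous_const)
  have hPUo : IsOpen (P ×ˢ ({x₀}ᶜ : Set E3)) := hPo.prod isOpen_compl_singleton
  -- `Ψ q = (q.1 0, q.2)` maps `P × U` into the slab
  have hΨ : AnalyticOnNhd ℝ (fun q : (Fin 2 → ℝ) × E3 => ((q.1 0, q.2) : ℝ × E3)) (P ×ˢ ({x₀}ᶜ : Set E3)) :=
    (((ContinuousLinearMap.proj 0).comp (ContinuousLinearMap.fst ℝ (Fin 2 → ℝ) E3)).analyticOnNhd _).prod analyticOnNhd_snd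
  have hΨmaps : ∀ q ∈ P ×ˢ ({x₀}ᶜ : Set E3), ((q.1 0, q.2) : ℝ × E3) ∈ Ioo t₀ 0 ×ˢ ({x₀}ᶜ : Set E3) :=
    fun q hq => ⟨⟨hq.1.1, hq.1.2⟩, hq.2⟩
  -- the model function built from `fderiv (uncurry T)`
  have hD : AnalyticOnNhd ℝ (fun q : (Fin 2 → ℝ) × E3 => fderiv ℝ (uncurry T) (q.1 0, q.2)) (P ×ˢ ({x₀}ᶜ : Set E3)) :=
    hT.fderiv.comp hΨ hΨmaps
  have hW : AnalyticOnNhd ℝ (fun q : (Fin 2 → ℝ) × E3 =>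
      Φ ((fderiv ℝ (uncurry T) (q.1 0, q.2)).comp (ContinuousLinearMap.inr ℝ ℝ E3))) (P ×ˢ ({x₀}ᶜ : Set E3)) := by
    have h1 : AnalyticOnNhd ℝ (fun q : (Fin 2 → ℝ) × E3 =>
        (fderiv ℝ (uncurry T) (q.1 0, q.2)).comp (ContinuousLinearMap.inr ℝ ℝ E3)) (P ×ˢ ({x₀}ᶜ : Set E3)) := by
      have := ((ContinuousLinearMap.precomp ℝ (ContinuousLinearMap.inr ℝ ℝ E3)).analyticOnNhd univ).comp hD
        (fun _ _ => mem_univ _)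
      simpa only [comp_def, ContinuousLinearMap.precomp_apply] using this
    exact (Φ.analyticOnNhd univ).comp h1 (fun _ _ => mem_univ _)
  have hsub : AnalyticOnNhd ℝ (fun q : (Fin 2 → ℝ) × E3 => q.2 - x₀) (P ×ˢ ({x₀}ᶜ : Set E3)) :=
    analyticOnNhd_snd.sub analyticOnNhd_const
  have hC : AnalyticOnNhd ℝ (fun q : (Fin 2 → ℝ) × E3 =>
      cross (Φ ((fderiv ℝ (uncurry T) (q.1 0, q.2)).comp (ContinuousLinearMap.inr ℝ ℝ E3))) (q.2 - x₀))
      (P ×ˢ ({x₀}ᶜ : Set E3)) := by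
    have := (crossCLM.analyticOnNhd_bilinear univ).comp₂ hW hsub (fun _ _ => mem_univ _)
    simpa only [crossCLM_apply] using this
  have hG' : AnalyticOnNhd ℝ (fun q : (Fin 2 → ℝ) × E3 =>
      ‖cross (Φ ((fderiv ℝ (uncurry T) (q.1 0, q.2)).comp (ContinuousLinearMap.inr ℝ ℝ E3))) (q.2 - x₀)‖ ^ 2)
      (P ×ˢ ({x₀}ᶜ : Set E3)) := by
    have h3 := ((innerSL ℝ (E := E3)).analyticOnNhd_bilinear univ).comp₂ hC hC (fun _ _ => mem_univ _)
    refine (h3.congr hPUo fun q _ => ?_)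
    exact real_inner_self_eq_norm_sq
      (cross (Φ ((fderiv ℝ (uncurry T) (q.1 0, q.2)).comp (ContinuousLinearMap.inr ℝ ℝ E3))) (q.2 - x₀))
  -- the model agrees with `G` on the open set
  refine hG'.congr hPUo fun q hq => ?_
  have hmem := hΨmaps q hq
  have hdiff : DifferentiableAt ℝ (uncurry T) (q.1 0, q.2) :=
    (hT _ hmem).differentiableAt
  have hfd : fderiv ℝ (T (q.1 0)) q.2 = (fderiv ℝ (uncurry T) (q.1 0, q.2)).comp (ContinuousLinearMap.inr ℝ ℝ E3) := by
    have h := hdiff.hasFDerivAt.comp q.2 (hasFDerivAt_prodMk_right (𝕜 := ℝ) (q.1 0) q.2)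
    exact h.fderiv
  simp only
  rw [show gradient (T (q.1 0)) q.2 = Φ (fderiv ℝ (T (q.1 0)) q.2) by rw [hΦ]; rfl, hfd]

/-- ★ **Λ-geo′(b) from F2**: `BierstoneMilman1988_fibre_components_bounded → AnalyticCellFinitenessUniformBox`, both bodies VERBATIM from
`Cruxes/PoloidalLiouville/IndicatrixSketch.lean` v1.7.3 (§F l.625; §1 l.329). [folklore] -/
theorem analyticCellFinitenessUniformBox_of
    (hF2 : ∀ (m : ℕ) (E : Type) [NormedAddCommGroup E] [NormedSpace ℝ E] [FiniteDimensional ℝ E]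
      (P : Set (Fin m → ℝ)) (U : Set E) (a b : Fin m → ℝ) (H G : (Fin m → ℝ) × E → ℝ),
      IsOpen P → IsOpen U → Set.Icc a b ⊆ P → AnalyticOnNhd ℝ H (P ×ˢ U) → AnalyticOnNhd ℝ G (P ×ˢ U) →
      IsCompact {q : (Fin m → ℝ) × E | q.1 ∈ Set.Icc a b ∧ q.2 ∈ U ∧ H q = 0} →
        ∃ N : ℕ, ∀ p ∈ Set.Icc a b,
          (connectedComponentIn {x | x ∈ U ∧ H (p, x) = 0 ∧ G (p, x) = 0} '' {x | x ∈ U ∧ H (p, x) = 0 ∧ G (p, x) = 0}).Finite ∧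
          (connectedComponentIn {x | x ∈ U ∧ H (p, x) = 0 ∧ G (p, x) = 0} '' {x | x ∈ U ∧ H (p, x) = 0 ∧ G (p, x) = 0}).ncard ≤ N ∧
          (connectedComponentIn {x | x ∈ U ∧ H (p, x) = 0 ∧ G (p, x) ≠ 0} '' {x | x ∈ U ∧ H (p, x) = 0 ∧ G (p, x) ≠ 0}).Finite ∧
          (connectedComponentIn {x | x ∈ U ∧ H (p, x) = 0 ∧ G (p, x) ≠ 0} '' {x | x ∈ U ∧ H (p, x) = 0 ∧ G (p, x) ≠ 0}).ncard ≤ N) :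
    ∀ (x₀ : E3) (T : ℝ → E3 → ℝ) (t₀ t₁ t₂ a b : ℝ), t₀ < t₁ → t₁ ≤ t₂ → t₂ < 0 → 0 < a → a ≤ b →
      AnalyticOnNhd ℝ (uncurry T) (Ioo t₀ 0 ×ˢ ({x₀}ᶜ : Set E3)) →
      ∃ N : ℕ, ∀ t ∈ Icc t₁ t₂, ∀ r ∈ Icc a b,
        (cellSet (T t) x₀ r).ncard ≤ N ∧ (isoCrit (T t) x₀ r).ncard ≤ N := by
  intro x₀ T t₀ t₁ t₂ a b h01 h12 h20 ha hab hT
  set P : Set (Fin 2 → ℝ) := {p : Fin 2 → ℝ | t₀ < p 0 ∧ p 0 < 0} with hP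
  have hPo : IsOpen P := by
    have h1 : Continuous fun p : Fin 2 → ℝ => p 0 := continuous_apply 0
    exact (isOpen_lt continuous_const h1).inter (isOpen_lt h1 continuous_const)
  have hbox : Icc (![t₁, a] : Fin 2 → ℝ) ![t₂, b] ⊆ P := by
    intro p hp
    have h1 : t₁ ≤ p 0 := by simpa using hp.1 0
    have h2 : p 0 ≤ t₂ := by simpa using hp.2 0
    exact ⟨h01.trans_le h1, h2.trans_lt h20⟩
  obtain ⟨N, hN⟩ := hF2 2 E3 P ({x₀}ᶜ : Set E3) ![t₁, a] ![t₂, b]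
    (fun q => ‖q.2 - x₀‖ ^ 2 - (q.1 1) ^ 2) (fun q => ‖cross (gradient (T (q.1 0)) q.2) (q.2 - x₀)‖ ^ 2)
    hPo isOpen_compl_singleton hbox (analyticOnNhd_H x₀ 1 _) (analyticOnNhd_G_box hT)
    (isCompact_sphereFamily x₀ ![t₁, a] ![t₂, b] 1 (by simpa using ha))
  refine ⟨N + N, fun t ht r hr => ?_⟩
  have hr0 : 0 < r := ha.trans_le hr.1
  obtain ⟨h0f, h0N, h1f, h1N⟩ := hN _ (vec2_mem_Icc ht hr)
  simp only [Matrix.cons_val_zero, Matrix.cons_val_one] at h0f h0N h1f h1N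
  rw [← sphCrit_eq_signSet' (T t) x₀ hr0] at h0f h0N
  rw [← sphere_diff_sphCrit_eq_signSet (T t) x₀ hr0] at h1f h1N
  obtain ⟨-, hcN⟩ := cellSet_finite_of_components_finite (T t) x₀ r h0f h1f
  obtain ⟨-, hiN⟩ := isoCrit_finite_of_components_finite (T t) x₀ r h0f
  exact ⟨hcN.trans (add_le_add h1N h0N), hiN.trans (h0N.trans (Nat.le_add_right N N))⟩

/-! ### By name, modulo the one standing fact «`ℝ_an,exp` is o-minimal» (F1/F2 = p710694) -/

/-- ★ **Λ-geo′(a) BY NAME** modulo `VandendriesMiller1994_realAnExp_isOMinimal`. [folklore] -/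
theorem analyticCellFinitenessUniformSlice_of_realAnExp
    (hO : Literature.ModelTheory.ExponentialFields.VandendriesMiller1994_realAnExp_isOMinimal) :
    ∀ (x₀ : E3) (f : E3 → ℝ) (a b : ℝ), 0 < a → a ≤ b → AnalyticOnNhd ℝ f ({x₀}ᶜ : Set E3) →
      ∃ N : ℕ, ∀ r ∈ Icc a b,
        (cellSet f x₀ r).Finite ∧ (cellSet f x₀ r).ncard ≤ N ∧ (isoCrit f x₀ r).Finite ∧ (isoCrit f x₀ r).ncard ≤ N :=
  analyticCellFinitenessUniformSlice_of
    (Literature.Analysis.Calculus.analyticSignSet_connectedComponents_finite_of_realAnExp_isOMinimal hO)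
    (Literature.Analysis.Calculus.analyticSignSet_fibre_connectedComponents_bounded_of_realAnExp_isOMinimal hO)

/-- ★ **Λ-geo′(b) BY NAME** modulo `VandendriesMiller1994_realAnExp_isOMinimal`. [folklore] -/
theorem analyticCellFinitenessUniformBox_of_realAnExp
    (hO : Literature.ModelTheory.ExponentialFields.VandendriesMiller1994_realAnExp_isOMinimal) :
    ∀ (x₀ : E3) (T : ℝ → E3 → ℝ) (t₀ t₁ t₂ a b : ℝ), t₀ < t₁ → t₁ ≤ t₂ → t₂ < 0 → 0 < a → a ≤ b →
      AnalyticOnNhd ℝ (uncurry T) (Ioo t₀ 0 ×ˢ ({x₀}ᶜ : Set E3)) →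
      ∃ N : ℕ, ∀ t ∈ Icc t₁ t₂, ∀ r ∈ Icc a b,
        (cellSet (T t) x₀ r).ncard ≤ N ∧ (isoCrit (T t) x₀ r).ncard ≤ N :=
  analyticCellFinitenessUniformBox_of
    (Literature.Analysis.Calculus.analyticSignSet_fibre_connectedComponents_bounded_of_realAnExp_isOMinimal hO)

end Summit.NavierStokesRegularity.NavierStokesRegularity.Theorems.PoloidalLiouville.Indicatrix

end
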